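import Mathlib.Analysis.SpecialFunctions.Complex.LogDeriv
import Mathlib.Analysis.SpecialFunctions.Complex.LogBounds
import Mathlib.Analysis.SpecialFunctions.Trigonometric.Bounds
import Mathlib.Analysis.Calculus.MeanValue
import Mathlib.Analysis.Calculus.Deriv.Prod
import Mathlib.Analysis.Complex.ExponentialBounds
import HarnessLib

/-!
# Davenport–Heilbronn for Epstein zeta functions, X: the phase calculus of one twisted prime

Sibling of `Literature/Barriers/RiemannHypothesis/EpsteinZetaRealZeros.lean` (named fact
`DavenportHeilbronn1936b_epstein`). Everything in this file is PROVED; no definitions, no named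
facts; no number fields — pure one-variable calculus.

In Davenport–Heilbronn II, §5, Lemma 2 ("For any given `δ > 0` there is a set of numbers `a(p)`
with `|a(p)| = 1` such that `F_a(s)` has a zero in `1 < s < 1 + δ`") the unimodular values `a(p)`
of the auxiliary completely multiplicative function are solved for inductively. In the tree's
variant of that argument (`EpsteinZetaRealZerosDHOdd.lean`) all but finitely many `a(p)` are
frozen, the moduli are steered by finitely many real flips, and ONE split prime `p₁` carries a
free phase `a(p₁) = e^{iφ}`, `φ ∈ [π/6, 5π/6]`; its local factor in `log M(s, χ)` is
`ℓ(χ(𝔭₁) x e^{iφ}) + ℓ(χ̄(𝔭₁) x e^{iφ})`, `ℓ(z) = −log(1 − z)`, `x = p₁^{-s}`. This file supplies the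
calculus of these local logarithms as functions of `φ`:

* `hasDerivAt_locLog` — `d/dφ ℓ(α x e^{iφ}) = i z/(1 − z)`, `z = α x e^{iφ}`, with
  `ℜ(i z/(1 − z)) = −ℑz/|1 − z|²` (`re_I_mul_div_one_sub`) and `|i z/(1 − z)| ≤ 2x`;
* `deriv_phaseGap_le` — for `|u| = 1` with `ℜu ≤ 0` and `0 < x ≤ 1/40` the *phase gap*
  `λ(φ) = 2ℜℓ(x e^{iφ}) − ℜℓ(u x e^{iφ}) − ℜℓ(ū x e^{iφ})` (`= log|1 − 2ℜu·x e^{iφ} + x²e^{2iφ}| −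
  2 log|1 − x e^{iφ}|`, the logarithm of the ratio of the moduli of the local factors of the
  principal and of a non-principal character) has `λ'(φ) ≤ −x/2` on `[π/6, 5π/6]`, hence
  decreases there at rate `≥ x/2` (`phaseGap_sub_le`);
* `norm_sub_le_of_locExp` — a finite combination `Σ_i k_i exp(ℓ(α_i ·) + ℓ(β_i ·) − ℓ(γ ·) − ℓ(δ ·))`
  is `48 x Σ|k_i|`-Lipschitz and bounded by `3 Σ|k_i|`;
* `abs_log_norm_add_sub_le` — `|log|W + ρ₂| − log|W + ρ₁|| ≤ 2|ρ₂ − ρ₁|/|W|` for `|ρ_j| ≤ |W|/2`;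
* `exists_continuousOn_zero_of_strictAntiOn` — the zero `φ(s)` of a jointly continuous
  `f(s, φ)`, strictly decreasing in `φ` with `f(s, a) > 0 > f(s, b)`, depends continuously on `s`.

## References

* [DavenportHeilbronn1936b] H. Davenport, H. Heilbronn, *On the zeros of certain Dirichlet
  series II*, J. London Math. Soc. 11 (1936), 307–312, §5 Lemma 2.
-/

noncomputable section

open Complex Filter Topology Set

namespace Literature.Barriers.RiemannHypothesis

namespace DHEpstein

/-! ## The local logarithm `ℓ(α x e^{iφ}) = −log(1 − α x e^{iφ})` -/

/-- `|α x e^{iφ}| = x` for `|α| = 1`, `x ≥ 0`. [folklore] -/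
theorem norm_mul_mul_cexp {α : ℂ} (hα : ‖α‖ = 1) {x : ℝ} (hx : 0 ≤ x) (φ : ℝ) :
    ‖α * x * cexp (φ * I)‖ = x := by
  rw [norm_mul, norm_mul, hα, one_mul, Complex.norm_real, Real.norm_eq_abs, abs_of_nonneg hx,
    Complex.norm_exp_ofReal_mul_I, mul_one]

/-- `1 − z` lies in the slit plane for `|z| ≤ 1/2`. [folklore] -/
theorem one_sub_mem_slitPlane_of_norm_le_half {z : ℂ} (hz : ‖z‖ ≤ 1 / 2) :
    1 - z ∈ slitPlane := by
  rw [sub_eq_add_neg]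
  exact mem_slitPlane_of_norm_lt_one (by rw [norm_neg]; linarith)

/-- `(1 − |z|)² ≤ |1 − z|² ≤ (1 + |z|)²`. [folklore] -/
theorem sq_norm_one_sub_mem {z : ℂ} (hz : ‖z‖ ≤ 1) :
    (1 - ‖z‖) ^ 2 ≤ ‖1 - z‖ ^ 2 ∧ ‖1 - z‖ ^ 2 ≤ (1 + ‖z‖) ^ 2 := by
  have h1 : 1 - ‖z‖ ≤ ‖1 - z‖ := by
    have := norm_sub_norm_le (1 : ℂ) z
    rwa [norm_one] at this
  have h2 : ‖1 - z‖ ≤ 1 + ‖z‖ := by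
    have := norm_sub_le (1 : ℂ) z
    rwa [norm_one] at this
  exact ⟨pow_le_pow_left₀ (by linarith) h1 2, pow_le_pow_left₀ (norm_nonneg _) h2 2⟩

/-- `ℜ(i z/(1 − z)) = −ℑz / |1 − z|²`. [folklore] -/
theorem re_I_mul_div_one_sub (z : ℂ) : (I * z / (1 - z)).re = -z.im / ‖1 - z‖ ^ 2 := by
  rw [Complex.div_re, Complex.normSq_eq_norm_sq]
  simp only [mul_re, mul_im, I_re, I_im, sub_re, sub_im, one_re, one_im, zero_mul, one_mul,
    zero_sub, zero_add]
  ring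

/-- `|i z/(1 − z)| ≤ 2|z|` for `|z| ≤ 1/2`. [folklore] -/
theorem norm_I_mul_div_one_sub_le {z : ℂ} (hz : ‖z‖ ≤ 1 / 2) : ‖I * z / (1 - z)‖ ≤ 2 * ‖z‖ := by
  have h1 : 1 / 2 ≤ ‖1 - z‖ := by
    have := norm_sub_norm_le (1 : ℂ) z
    rw [norm_one] at this
    linarith
  rw [norm_div, norm_mul, Complex.norm_I, one_mul, div_le_iff₀ (by linarith)]
  nlinarith [norm_nonneg z]

/-- `|−log(1 − z)| ≤ (3/2)|z|` for `|z| ≤ 1/2`. [folklore] -/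
theorem norm_neg_log_one_sub_le {z : ℂ} (hz : ‖z‖ ≤ 1 / 2) : ‖-Complex.log (1 - z)‖ ≤ 3 / 2 * ‖z‖ := by
  rw [norm_neg, sub_eq_add_neg]
  have h := Complex.norm_log_one_add_half_le_self (z := -z) (by rwa [norm_neg])
  rwa [norm_neg] at h

/-- **The derivative of the local logarithm**: `φ ↦ −log(1 − α x e^{iφ})` has derivative
`i z/(1 − z)`, `z = α x e^{iφ}` (`|α| = 1`, `0 ≤ x ≤ 1/2`). [folklore] -/
theorem hasDerivAt_locLog {α : ℂ} (hα : ‖α‖ = 1) {x : ℝ} (hx0 : 0 ≤ x) (hx : x ≤ 1 / 2) (φ : ℝ) :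
    HasDerivAt (fun φ : ℝ ↦ -Complex.log (1 - α * x * cexp (φ * I)))
      (I * (α * x * cexp (φ * I)) / (1 - α * x * cexp (φ * I))) φ := by
  have h1 : HasDerivAt (fun φ : ℝ ↦ (φ : ℂ) * I) I φ := by
    simpa using ((hasDerivAt_id φ).ofReal_comp).mul_const I
  have h2 : HasDerivAt (fun φ : ℝ ↦ cexp ((φ : ℂ) * I)) (cexp ((φ : ℂ) * I) * I) φ := h1.cexp
  have h3 : HasDerivAt (fun φ : ℝ ↦ 1 - α * x * cexp ((φ : ℂ) * I))
      (-(α * x * (cexp ((φ : ℂ) * I) * I))) φ := (h2.const_mul (α * (x : ℂ))).const_sub 1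
  have hmem : 1 - α * x * cexp ((φ : ℂ) * I) ∈ slitPlane :=
    one_sub_mem_slitPlane_of_norm_le_half (by rw [norm_mul_mul_cexp hα hx0]; exact hx)
  have h4 := (h3.clog_real hmem).neg
  have e : -(-(α * ↑x * (cexp (↑φ * I) * I)) / (1 - α * ↑x * cexp (↑φ * I))) =
      I * (α * x * cexp (φ * I)) / (1 - α * x * cexp (φ * I)) := by
    rw [neg_div, neg_neg]
    ring
  rw [e] at h4
  exact h4

/-- The local logarithm is continuous in `φ`. [folklore] -/
theorem continuous_locLog {α : ℂ} (hα : ‖α‖ = 1) {x : ℝ} (hx0 : 0 ≤ x) (hx : x ≤ 1 / 2) :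
    Continuous (fun φ : ℝ ↦ -Complex.log (1 - α * x * cexp (φ * I))) :=
  continuous_iff_continuousAt.2 fun φ ↦ (hasDerivAt_locLog hα hx0 hx φ).continuousAt

/-- The real part of the local logarithm has derivative `−ℑz/|1 − z|²`. [folklore] -/
theorem hasDerivAt_re_locLog {α : ℂ} (hα : ‖α‖ = 1) {x : ℝ} (hx0 : 0 ≤ x) (hx : x ≤ 1 / 2) (φ : ℝ) :
    HasDerivAt (fun φ : ℝ ↦ (-Complex.log (1 - α * x * cexp (φ * I))).re)
      (-(α * x * cexp (φ * I)).im / ‖1 - α * x * cexp (φ * I)‖ ^ 2) φ := by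
  have h := hasDerivAt_locLog hα hx0 hx φ
  have h2 := Complex.reCLM.hasFDerivAt.comp_hasDerivAt φ h
  rw [← re_I_mul_div_one_sub]
  exact h2

/-! ## The phase gap `λ(φ) = 2ℜℓ(x e^{iφ}) − ℜℓ(u x e^{iφ}) − ℜℓ(ū x e^{iφ})` -/

/-- `sin φ ≥ 1/2` on `[π/6, 5π/6]`. [folklore] -/
theorem half_le_sin {φ : ℝ} (h1 : Real.pi / 6 ≤ φ) (h2 : φ ≤ 5 * Real.pi / 6) : 1 / 2 ≤ Real.sin φ := by
  have key : ∀ ψ : ℝ, Real.pi / 6 ≤ ψ → ψ ≤ Real.pi / 2 → 1 / 2 ≤ Real.sin ψ := by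
    intro ψ hψ1 hψ2
    rw [← Real.sin_pi_div_six]
    exact Real.sin_le_sin_of_le_of_le_pi_div_two (by linarith [Real.pi_pos]) hψ2 hψ1
  by_cases h : φ ≤ Real.pi / 2
  · exact key φ h1 h
  · rw [← Real.sin_pi_sub]
    exact key (Real.pi - φ) (by linarith) (by push Not at h; linarith)

/-- The elementary inequality behind `deriv_phaseGap_le`. [folklore] -/
theorem key_phaseGap_ineq {x : ℝ} (hx0 : 0 ≤ x) (hx : x ≤ 1 / 40) :
    1 / (1 - x) ^ 2 - 2 / (1 + x) ^ 2 ≤ -(1 / 2) := by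
  have h1 : 0 < (1 - x) ^ 2 := by nlinarith
  have h2 : 0 < (1 + x) ^ 2 := by nlinarith
  rw [div_sub_div _ _ h1.ne' h2.ne', div_le_iff₀ (mul_pos h1 h2)]
  nlinarith [mul_nonneg hx0 hx0, mul_nonneg (mul_nonneg hx0 hx0) hx0,
    mul_nonneg (mul_nonneg hx0 hx0) (mul_nonneg hx0 hx0)]

/-- Abstract form of the derivative bound: with `S = sin φ ≥ 1/2`, `c = ℜu ≤ 0`, `|m| ≤ 1` and
squared moduli `d₀, d₊, d₋ ∈ [(1 − x)², (1 + x)²]`,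
`−2S/d₀ + (cS + m)/d₊ + (cS − m)/d₋ ≤ −1/2`. [folklore] -/
theorem phaseGap_combination_le {x S c m d₀ dp dm : ℝ} (hx0 : 0 ≤ x) (hx : x ≤ 1 / 40)
    (hS : 1 / 2 ≤ S) (hc : c ≤ 0) (hm : |m| ≤ 1)
    (hd₀ : (1 - x) ^ 2 ≤ d₀ ∧ d₀ ≤ (1 + x) ^ 2) (hdp : (1 - x) ^ 2 ≤ dp ∧ dp ≤ (1 + x) ^ 2)
    (hdm : (1 - x) ^ 2 ≤ dm ∧ dm ≤ (1 + x) ^ 2) :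
    -2 * S / d₀ + (c * S + m) / dp + (c * S - m) / dm ≤ -(1 / 2) := by
  have hl : 0 < (1 - x) ^ 2 := by nlinarith
  have hu : 0 < (1 + x) ^ 2 := by nlinarith
  have hd₀0 : 0 < d₀ := lt_of_lt_of_le hl hd₀.1
  have hdp0 : 0 < dp := lt_of_lt_of_le hl hdp.1
  have hdm0 : 0 < dm := lt_of_lt_of_le hl hdm.1
  -- the `c`-terms are `≤ 0`
  have hcS : c * S ≤ 0 := mul_nonpos_of_nonpos_of_nonneg hc (by linarith)
  have e1 : (c * S + m) / dp + (c * S - m) / dm = c * S / dp + c * S / dm + m * (1 / dp - 1 / dm) := by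
    field_simp; ring
  have t1 : c * S / dp ≤ 0 := div_nonpos_of_nonpos_of_nonneg hcS hdp0.le
  have t2 : c * S / dm ≤ 0 := div_nonpos_of_nonpos_of_nonneg hcS hdm0.le
  -- the `m`-term is at most the spread of `1/d`
  have hinv : ∀ d : ℝ, (1 - x) ^ 2 ≤ d ∧ d ≤ (1 + x) ^ 2 →
      1 / (1 + x) ^ 2 ≤ 1 / d ∧ 1 / d ≤ 1 / (1 - x) ^ 2 := fun d hd ↦
    ⟨one_div_le_one_div_of_le (lt_of_lt_of_le hl hd.1) hd.2, one_div_le_one_div_of_le hl hd.1⟩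
  have t3 : m * (1 / dp - 1 / dm) ≤ 1 / (1 - x) ^ 2 - 1 / (1 + x) ^ 2 := by
    have hsp : |1 / dp - 1 / dm| ≤ 1 / (1 - x) ^ 2 - 1 / (1 + x) ^ 2 := by
      rw [abs_sub_le_iff]
      constructor <;> linarith [(hinv dp hdp).1, (hinv dp hdp).2, (hinv dm hdm).1, (hinv dm hdm).2]
    calc m * (1 / dp - 1 / dm) ≤ |m * (1 / dp - 1 / dm)| := le_abs_self _
      _ = |m| * |1 / dp - 1 / dm| := abs_mul _ _
      _ ≤ 1 * (1 / (1 - x) ^ 2 - 1 / (1 + x) ^ 2) :=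
          mul_le_mul hm hsp (abs_nonneg _) zero_le_one
      _ = _ := one_mul _
  -- the main term
  have t4 : -2 * S / d₀ ≤ -(1 / (1 + x) ^ 2) := by
    rw [neg_mul, neg_div, neg_le_neg_iff, div_le_div_iff₀ hu hd₀0, one_mul]
    nlinarith [hd₀.2]
  have := key_phaseGap_ineq hx0 hx
  have e2 : (2 : ℝ) / (1 + x) ^ 2 = 2 * (1 / (1 + x) ^ 2) := by ring
  rw [e2] at this
  linarith

/-- `e^{iφ}` has imaginary part `sin φ` and real part `cos φ`; the imaginary parts of
`u x e^{iφ}` and `ū x e^{iφ}` add up to `2 ℜu · x sin φ`. [folklore] -/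
theorem im_mul_mul_cexp (u : ℂ) (x φ : ℝ) :
    (u * x * cexp (φ * I)).im = x * (u.re * Real.sin φ + u.im * Real.cos φ) := by
  rw [Complex.exp_mul_I]
  simp only [mul_im, mul_re, ofReal_re, ofReal_im, add_re, add_im, Complex.cos_ofReal_re,
    Complex.cos_ofReal_im, Complex.sin_ofReal_re, Complex.sin_ofReal_im, I_re, I_im, mul_zero,
    mul_one, sub_zero, zero_add, add_zero]
  ring

/-- For `|u| = 1`, `u⁻¹ = ū` has real part `ℜu` and imaginary part `−ℑu`. [folklore] -/
theorem inv_re_im_of_norm_eq_one {u : ℂ} (hu : ‖u‖ = 1) : (u⁻¹).re = u.re ∧ (u⁻¹).im = -u.im := by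
  rw [Complex.inv_eq_conj hu]
  exact ⟨Complex.conj_re u, Complex.conj_im u⟩

/-- **The phase gap decreases at rate `≥ x/2`.** For `|u| = 1`, `ℜu ≤ 0`, `0 < x ≤ 1/40` and
`φ ∈ [π/6, 5π/6]`, the derivative of
`λ(φ) = 2ℜℓ(x e^{iφ}) − ℜℓ(u x e^{iφ}) − ℜℓ(u⁻¹ x e^{iφ})`, `ℓ(z) = −log(1 − z)`, is `≤ −x/2`.
(`λ' = −x[2 sin φ/|1 − xe^{iφ}|² − ℑ(ue^{iφ})/|1 − uxe^{iφ}|² − ℑ(ūe^{iφ})/|1 − ūxe^{iφ}|²]`,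
`ℑ(ue^{iφ}) + ℑ(ūe^{iφ}) = 2ℜu sin φ ≤ 0`, and the squared moduli lie in `[(1−x)², (1+x)²]`.)
[cite: DavenportHeilbronn1936b, §5 Lemma 2] -/
theorem hasDerivAt_phaseGap_le {u : ℂ} (hu : ‖u‖ = 1) (hc : u.re ≤ 0) {x : ℝ} (hx0 : 0 < x)
    (hx : x ≤ 1 / 40) {φ : ℝ} (h1 : Real.pi / 6 ≤ φ) (h2 : φ ≤ 5 * Real.pi / 6) :
    ∃ D : ℝ, HasDerivAt (fun φ : ℝ ↦ 2 * (-Complex.log (1 - 1 * x * cexp (φ * I))).re -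
        (-Complex.log (1 - u * x * cexp (φ * I))).re - (-Complex.log (1 - u⁻¹ * x * cexp (φ * I))).re) D φ ∧
      D ≤ -(x / 2) := by
  have hx2 : x ≤ 1 / 2 := by linarith
  have hu1 : ‖(1 : ℂ)‖ = 1 := norm_one
  have hui : ‖u⁻¹‖ = 1 := by rw [norm_inv, hu, inv_one]
  have d1 := hasDerivAt_re_locLog hu1 hx0.le hx2 φ
  have d2 := hasDerivAt_re_locLog hu hx0.le hx2 φ
  have d3 := hasDerivAt_re_locLog hui hx0.le hx2 φ
  refine ⟨_, ((d1.const_mul 2).sub d2).sub d3, ?_⟩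
  -- the three moduli
  set z₀ := (1 : ℂ) * x * cexp (φ * I) with hz₀
  set zp := u * x * cexp (φ * I) with hzp
  set zm := u⁻¹ * x * cexp (φ * I) with hzm
  have hn₀ : ‖z₀‖ = x := norm_mul_mul_cexp hu1 hx0.le φ
  have hnp : ‖zp‖ = x := norm_mul_mul_cexp hu hx0.le φ
  have hnm : ‖zm‖ = x := norm_mul_mul_cexp hui hx0.le φ
  have hx1 : x ≤ 1 := by linarith
  have hd₀ := sq_norm_one_sub_mem (z := z₀) (by rw [hn₀]; exact hx1)
  have hdp := sq_norm_one_sub_mem (z := zp) (by rw [hnp]; exact hx1)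
  have hdm := sq_norm_one_sub_mem (z := zm) (by rw [hnm]; exact hx1)
  rw [hn₀] at hd₀; rw [hnp] at hdp; rw [hnm] at hdm
  -- the three imaginary parts
  have hi₀ : z₀.im = x * Real.sin φ := by
    rw [hz₀, im_mul_mul_cexp]; simp
  have hip : zp.im = x * (u.re * Real.sin φ + u.im * Real.cos φ) := by rw [hzp, im_mul_mul_cexp]
  have him : zm.im = x * (u.re * Real.sin φ - u.im * Real.cos φ) := by
    rw [hzm, im_mul_mul_cexp, (inv_re_im_of_norm_eq_one hu).1, (inv_re_im_of_norm_eq_one hu).2]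
    ring
  rw [hi₀, hip, him]
  -- reduce to the abstract inequality
  set S := Real.sin φ with hS
  set m := u.im * Real.cos φ with hm
  have hS1 : 1 / 2 ≤ S := half_le_sin h1 h2
  have hmabs : |m| ≤ 1 := by
    rw [hm, abs_mul]
    have h1' : |u.im| ≤ 1 := by
      have := Complex.abs_im_le_norm u; rwa [hu] at this
    have h2' : |Real.cos φ| ≤ 1 := Real.abs_cos_le_one φ
    exact mul_le_one₀ h1' (abs_nonneg _) h2'
  have key := phaseGap_combination_le hx0.le hx hS1 hc hmabs hd₀ hdp hdm
  have hx' : 0 ≤ x := hx0.le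
  calc 2 * (-(x * S) / ‖1 - z₀‖ ^ 2) - -(x * (u.re * S + m)) / ‖1 - zp‖ ^ 2 -
        -(x * (u.re * S - m)) / ‖1 - zm‖ ^ 2
      = x * (-2 * S / ‖1 - z₀‖ ^ 2 + (u.re * S + m) / ‖1 - zp‖ ^ 2 + (u.re * S - m) / ‖1 - zm‖ ^ 2) := by
        ring
    _ ≤ x * (-(1 / 2)) := mul_le_mul_of_nonneg_left key hx'
    _ = -(x / 2) := by ring

/-- **Quantitative decrease of the phase gap** on `[π/6, 5π/6]`: for `φ₁ ≤ φ₂` there,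
`λ(φ₂) − λ(φ₁) ≤ −(x/2)(φ₂ − φ₁)` (mean value theorem). [cite: DavenportHeilbronn1936b, §5 Lemma 2] -/
theorem phaseGap_sub_le {u : ℂ} (hu : ‖u‖ = 1) (hc : u.re ≤ 0) {x : ℝ} (hx0 : 0 < x)
    (hx : x ≤ 1 / 40) {φ₁ φ₂ : ℝ} (h1 : Real.pi / 6 ≤ φ₁) (h12 : φ₁ ≤ φ₂) (h2 : φ₂ ≤ 5 * Real.pi / 6) :
    (2 * (-Complex.log (1 - 1 * x * cexp (φ₂ * I))).re -
        (-Complex.log (1 - u * x * cexp (φ₂ * I))).re - (-Complex.log (1 - u⁻¹ * x * cexp (φ₂ * I))).re) -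
      (2 * (-Complex.log (1 - 1 * x * cexp (φ₁ * I))).re -
        (-Complex.log (1 - u * x * cexp (φ₁ * I))).re - (-Complex.log (1 - u⁻¹ * x * cexp (φ₁ * I))).re) ≤
      -(x / 2) * (φ₂ - φ₁) := by
  set lam : ℝ → ℝ := fun φ ↦ 2 * (-Complex.log (1 - 1 * x * cexp (φ * I))).re -
    (-Complex.log (1 - u * x * cexp (φ * I))).re - (-Complex.log (1 - u⁻¹ * x * cexp (φ * I))).re with hlam
  set D : Set ℝ := Icc (Real.pi / 6) (5 * Real.pi / 6) with hD
  have hx2 : x ≤ 1 / 2 := by linarith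
  have hui : ‖u⁻¹‖ = 1 := by rw [norm_inv, hu, inv_one]
  -- differentiability everywhere
  have hderiv : ∀ φ : ℝ, HasDerivAt lam
      (2 * (-((1 : ℂ) * x * cexp (φ * I)).im / ‖1 - (1 : ℂ) * x * cexp (φ * I)‖ ^ 2) -
        -(u * x * cexp (φ * I)).im / ‖1 - u * x * cexp (φ * I)‖ ^ 2 -
        -(u⁻¹ * x * cexp (φ * I)).im / ‖1 - u⁻¹ * x * cexp (φ * I)‖ ^ 2) φ := fun φ ↦
    (((hasDerivAt_re_locLog norm_one hx0.le hx2 φ).const_mul 2).sub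
      (hasDerivAt_re_locLog hu hx0.le hx2 φ)).sub (hasDerivAt_re_locLog hui hx0.le hx2 φ)
  have hcont : ContinuousOn lam D := fun φ _ ↦ (hderiv φ).continuousAt.continuousWithinAt
  have hdiff : DifferentiableOn ℝ lam (interior D) := fun φ _ ↦
    (hderiv φ).differentiableAt.differentiableWithinAt
  have hbound : ∀ φ ∈ interior D, deriv lam φ ≤ -(x / 2) := by
    intro φ hφ
    rw [hD, interior_Icc] at hφ
    obtain ⟨Dφ, hDφ, hle⟩ := hasDerivAt_phaseGap_le hu hc hx0 hx hφ.1.le hφ.2.le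
    rw [hDφ.deriv]
    exact hle
  have hconv : Convex ℝ D := convex_Icc _ _
  exact hconv.image_sub_le_mul_sub_of_deriv_le hcont hdiff hbound φ₁ ⟨h1, h12.trans h2⟩ φ₂
    ⟨h1.trans h12, h2⟩ h12

/-! ## Lipschitz bounds for finite combinations of local exponentials -/

/-- `|exp(L)| ≤ 3` when `|L| ≤ 1`. [folklore] -/
theorem norm_cexp_le_three {L : ℂ} (hL : ‖L‖ ≤ 1) : ‖cexp L‖ ≤ 3 := by
  rw [Complex.norm_exp]
  have h1 : L.re ≤ 1 := (Complex.re_le_norm L).trans hL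
  calc Real.exp L.re ≤ Real.exp 1 := Real.exp_le_exp.2 h1
    _ ≤ 3 := by have := Real.exp_one_lt_d9; linarith

/-- **Lipschitz bound for a combination of local exponentials.** For unit `α_i, β_i, γ, δ`,
`0 ≤ x ≤ 1/40` and coefficients `k_i`, the function
`ρ(φ) = Σ_i k_i exp(ℓ(α_i x e^{iφ}) + ℓ(β_i x e^{iφ}) − ℓ(γ x e^{iφ}) − ℓ(δ x e^{iφ}))`
satisfies `|ρ(φ)| ≤ 3 Σ|k_i|` and `|ρ(φ₂) − ρ(φ₁)| ≤ 24 x (Σ|k_i|) |φ₂ − φ₁|`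
(each exponent has modulus `≤ 6x ≤ 1` and derivative of modulus `≤ 8x`). [folklore] -/
theorem norm_sub_le_of_locExp {ι : Type*} (s : Finset ι) (k α β : ι → ℂ) (γ δ : ℂ)
    (hα : ∀ i ∈ s, ‖α i‖ = 1) (hβ : ∀ i ∈ s, ‖β i‖ = 1) (hγ : ‖γ‖ = 1) (hδ : ‖δ‖ = 1)
    {x : ℝ} (hx0 : 0 ≤ x) (hx : x ≤ 1 / 40) :
    (∀ φ : ℝ, ‖∑ i ∈ s, k i * cexp (-Complex.log (1 - α i * x * cexp (φ * I)) +
        -Complex.log (1 - β i * x * cexp (φ * I)) - -Complex.log (1 - γ * x * cexp (φ * I)) -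
        -Complex.log (1 - δ * x * cexp (φ * I)))‖ ≤ 3 * ∑ i ∈ s, ‖k i‖) ∧
    ∀ φ₁ φ₂ : ℝ, ‖(∑ i ∈ s, k i * cexp (-Complex.log (1 - α i * x * cexp (φ₂ * I)) +
        -Complex.log (1 - β i * x * cexp (φ₂ * I)) - -Complex.log (1 - γ * x * cexp (φ₂ * I)) -
        -Complex.log (1 - δ * x * cexp (φ₂ * I)))) -
      (∑ i ∈ s, k i * cexp (-Complex.log (1 - α i * x * cexp (φ₁ * I)) +
        -Complex.log (1 - β i * x * cexp (φ₁ * I)) - -Complex.log (1 - γ * x * cexp (φ₁ * I)) -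
        -Complex.log (1 - δ * x * cexp (φ₁ * I))))‖ ≤ 24 * x * (∑ i ∈ s, ‖k i‖) * |φ₂ - φ₁| := by
  have hx2 : x ≤ 1 / 2 := by linarith
  -- notation for the exponent of index `i`
  set L : ι → ℝ → ℂ := fun i φ ↦ -Complex.log (1 - α i * x * cexp (φ * I)) +
    -Complex.log (1 - β i * x * cexp (φ * I)) - -Complex.log (1 - γ * x * cexp (φ * I)) -
    -Complex.log (1 - δ * x * cexp (φ * I)) with hL
  -- size of one local logarithm
  have hsz : ∀ {a : ℂ}, ‖a‖ = 1 → ∀ φ : ℝ, ‖-Complex.log (1 - a * x * cexp (φ * I))‖ ≤ 3 / 2 * x := by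
    intro a ha φ
    have := norm_neg_log_one_sub_le (z := a * x * cexp (φ * I)) (by rw [norm_mul_mul_cexp ha hx0]; exact hx2)
    rwa [norm_mul_mul_cexp ha hx0] at this
  have hLnorm : ∀ i ∈ s, ∀ φ, ‖L i φ‖ ≤ 1 := by
    intro i hi φ
    calc ‖L i φ‖ ≤ ‖-Complex.log (1 - α i * x * cexp (φ * I))‖ + ‖-Complex.log (1 - β i * x * cexp (φ * I))‖ +
          ‖-Complex.log (1 - γ * x * cexp (φ * I))‖ + ‖-Complex.log (1 - δ * x * cexp (φ * I))‖ := by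
          simp only [hL]
          refine (norm_sub_le _ _).trans (add_le_add ((norm_sub_le _ _).trans (add_le_add
            (norm_add_le _ _) le_rfl)) le_rfl)
      _ ≤ 3 / 2 * x + 3 / 2 * x + 3 / 2 * x + 3 / 2 * x :=
          add_le_add (add_le_add (add_le_add (hsz (hα i hi) φ) (hsz (hβ i hi) φ)) (hsz hγ φ)) (hsz hδ φ)
      _ ≤ 1 := by linarith
  -- derivative of one local logarithm and its size
  have hder : ∀ {a : ℂ}, ‖a‖ = 1 → ∀ φ : ℝ, ∃ d : ℂ,
      HasDerivAt (fun φ : ℝ ↦ -Complex.log (1 - a * x * cexp (φ * I))) d φ ∧ ‖d‖ ≤ 2 * x := by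
    intro a ha φ
    refine ⟨_, hasDerivAt_locLog ha hx0 hx2 φ, ?_⟩
    have := norm_I_mul_div_one_sub_le (z := a * x * cexp (φ * I)) (by rw [norm_mul_mul_cexp ha hx0]; exact hx2)
    rwa [norm_mul_mul_cexp ha hx0] at this
  have hLder : ∀ i ∈ s, ∀ φ, ∃ d : ℂ, HasDerivAt (L i) d φ ∧ ‖d‖ ≤ 8 * x := by
    intro i hi φ
    obtain ⟨d1, hd1, n1⟩ := hder (hα i hi) φ
    obtain ⟨d2, hd2, n2⟩ := hder (hβ i hi) φ
    obtain ⟨d3, hd3, n3⟩ := hder hγ φ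
    obtain ⟨d4, hd4, n4⟩ := hder hδ φ
    refine ⟨d1 + d2 - d3 - d4, ((hd1.add hd2).sub hd3).sub hd4, ?_⟩
    calc ‖d1 + d2 - d3 - d4‖ ≤ ‖d1‖ + ‖d2‖ + ‖d3‖ + ‖d4‖ := by
          refine (norm_sub_le _ _).trans (add_le_add ((norm_sub_le _ _).trans (add_le_add
            (norm_add_le _ _) le_rfl)) le_rfl)
      _ ≤ 8 * x := by linarith
  constructor
  · -- the bound
    intro φ
    calc ‖∑ i ∈ s, k i * cexp (L i φ)‖ ≤ ∑ i ∈ s, ‖k i * cexp (L i φ)‖ := norm_sum_le _ _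
      _ ≤ ∑ i ∈ s, ‖k i‖ * 3 := Finset.sum_le_sum fun i hi ↦ by
          rw [norm_mul]
          exact mul_le_mul_of_nonneg_left (norm_cexp_le_three (hLnorm i hi φ)) (norm_nonneg _)
      _ = 3 * ∑ i ∈ s, ‖k i‖ := by rw [← Finset.sum_mul]; ring
  · -- the Lipschitz bound, by the mean value inequality for `ρ`
    intro φ₁ φ₂
    set ρ : ℝ → ℂ := fun φ ↦ ∑ i ∈ s, k i * cexp (L i φ) with hρ
    have hρder : ∀ φ : ℝ, ∃ d : ℂ, HasDerivAt ρ d φ ∧ ‖d‖ ≤ 24 * x * ∑ i ∈ s, ‖k i‖ := by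
      intro φ
      have hterm : ∀ i ∈ s, ∃ d : ℂ, HasDerivAt (fun φ ↦ k i * cexp (L i φ)) d φ ∧ ‖d‖ ≤ ‖k i‖ * (24 * x) := by
        intro i hi
        obtain ⟨d, hd, nd⟩ := hLder i hi φ
        refine ⟨k i * (cexp (L i φ) * d), (hd.cexp).const_mul (k i), ?_⟩
        rw [norm_mul, norm_mul]
        refine mul_le_mul_of_nonneg_left ?_ (norm_nonneg _)
        calc ‖cexp (L i φ)‖ * ‖d‖ ≤ 3 * (8 * x) :=
              mul_le_mul (norm_cexp_le_three (hLnorm i hi φ)) nd (norm_nonneg _) (by norm_num)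
          _ = 24 * x := by ring
      choose! d hd using hterm
      refine ⟨∑ i ∈ s, d i, ?_, ?_⟩
      · have := HasDerivAt.sum (u := s) (A := fun i φ ↦ k i * cexp (L i φ)) (A' := fun i ↦ d i)
          (x := φ) (fun i hi ↦ (hd i hi).1)
        rw [Finset.sum_fn] at this
        exact this
      · calc ‖∑ i ∈ s, d i‖ ≤ ∑ i ∈ s, ‖d i‖ := norm_sum_le _ _
          _ ≤ ∑ i ∈ s, ‖k i‖ * (24 * x) := Finset.sum_le_sum fun i hi ↦ (hd i hi).2
          _ = 24 * x * ∑ i ∈ s, ‖k i‖ := by rw [← Finset.sum_mul]; ring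
    choose d hd using hρder
    have hmvt := Convex.norm_image_sub_le_of_norm_hasDerivWithin_le (f := ρ) (f' := d)
      (s := Set.univ) (fun φ _ ↦ (hd φ).1.hasDerivWithinAt) (fun φ _ ↦ (hd φ).2) convex_univ
      (Set.mem_univ φ₁) (Set.mem_univ φ₂)
    rw [Real.norm_eq_abs] at hmvt
    simpa only [hρ] using hmvt

/-- **Log-modulus Lipschitz bound**: for `|ρ₁|, |ρ₂| ≤ |W|/2` (`W ≠ 0`),
`|log|W + ρ₂| − log|W + ρ₁|| ≤ 2|ρ₂ − ρ₁|/|W|`. [folklore] -/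
theorem abs_log_norm_add_sub_le {W ρ₁ ρ₂ : ℂ} (hW : W ≠ 0) (h₁ : ‖ρ₁‖ ≤ ‖W‖ / 2) (h₂ : ‖ρ₂‖ ≤ ‖W‖ / 2) :
    |Real.log ‖W + ρ₂‖ - Real.log ‖W + ρ₁‖| ≤ 2 * ‖ρ₂ - ρ₁‖ / ‖W‖ := by
  have hW0 : 0 < ‖W‖ := norm_pos_iff.2 hW
  have hlow : ∀ {ρ : ℂ}, ‖ρ‖ ≤ ‖W‖ / 2 → ‖W‖ / 2 ≤ ‖W + ρ‖ := fun {ρ} h ↦ by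
    have := norm_sub_norm_le W (-ρ)
    rw [sub_neg_eq_add, norm_neg] at this
    linarith
  have ha : ‖W‖ / 2 ≤ ‖W + ρ₁‖ := hlow h₁
  have hb : ‖W‖ / 2 ≤ ‖W + ρ₂‖ := hlow h₂
  have ha0 : 0 < ‖W + ρ₁‖ := by linarith
  have hb0 : 0 < ‖W + ρ₂‖ := by linarith
  have hdiff : |‖W + ρ₂‖ - ‖W + ρ₁‖| ≤ ‖ρ₂ - ρ₁‖ := by
    have := abs_norm_sub_norm_le (W + ρ₂) (W + ρ₁)
    rwa [add_sub_add_left_eq_sub] at this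
  -- `log b - log a ≤ (b - a)/a` and `log a - log b ≤ (a - b)/b`
  have h1 : Real.log ‖W + ρ₂‖ - Real.log ‖W + ρ₁‖ ≤ (‖W + ρ₂‖ - ‖W + ρ₁‖) / ‖W + ρ₁‖ := by
    have := Real.log_le_sub_one_of_pos (div_pos hb0 ha0)
    rw [Real.log_div hb0.ne' ha0.ne'] at this
    rwa [sub_div, div_self ha0.ne']
  have h2 : Real.log ‖W + ρ₁‖ - Real.log ‖W + ρ₂‖ ≤ (‖W + ρ₁‖ - ‖W + ρ₂‖) / ‖W + ρ₂‖ := by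
    have := Real.log_le_sub_one_of_pos (div_pos ha0 hb0)
    rw [Real.log_div ha0.ne' hb0.ne'] at this
    rwa [sub_div, div_self hb0.ne']
  rw [abs_le]
  constructor
  · -- lower bound
    have h3 : (‖W + ρ₁‖ - ‖W + ρ₂‖) / ‖W + ρ₂‖ ≤ ‖ρ₂ - ρ₁‖ / (‖W‖ / 2) := by
      calc (‖W + ρ₁‖ - ‖W + ρ₂‖) / ‖W + ρ₂‖ ≤ |‖W + ρ₂‖ - ‖W + ρ₁‖| / ‖W + ρ₂‖ := by
            gcongr; rw [abs_sub_comm]; exact le_abs_self _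
        _ ≤ ‖ρ₂ - ρ₁‖ / (‖W‖ / 2) := by gcongr
    have : ‖ρ₂ - ρ₁‖ / (‖W‖ / 2) = 2 * ‖ρ₂ - ρ₁‖ / ‖W‖ := by field_simp
    linarith
  · have h3 : (‖W + ρ₂‖ - ‖W + ρ₁‖) / ‖W + ρ₁‖ ≤ ‖ρ₂ - ρ₁‖ / (‖W‖ / 2) := by
      calc (‖W + ρ₂‖ - ‖W + ρ₁‖) / ‖W + ρ₁‖ ≤ |‖W + ρ₂‖ - ‖W + ρ₁‖| / ‖W + ρ₁‖ := by
            gcongr; exact le_abs_self _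
        _ ≤ ‖ρ₂ - ρ₁‖ / (‖W‖ / 2) := by gcongr
    have : ‖ρ₂ - ρ₁‖ / (‖W‖ / 2) = 2 * ‖ρ₂ - ρ₁‖ / ‖W‖ := by field_simp
    linarith

/-! ## Continuous dependence of the zero of a strictly decreasing section -/

/-- **Monotone implicit-function lemma.** Let `f(s, φ)` be continuous on `S × [a, b]` and, for
each `s ∈ S`, strictly decreasing in `φ ∈ [a, b]` with `f(s, a) > 0 > f(s, b)`. Then the unique
zero `φ(s) ∈ (a, b)` of `f(s, ·)` depends continuously on `s ∈ S`. [folklore] -/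
theorem exists_continuousOn_zero_of_strictAntiOn {f : ℝ → ℝ → ℝ} {S : Set ℝ} {a b : ℝ} (hab : a ≤ b)
    (hf : ContinuousOn (fun q : ℝ × ℝ ↦ f q.1 q.2) (S ×ˢ Icc a b))
    (hanti : ∀ s ∈ S, StrictAntiOn (f s) (Icc a b))
    (ha : ∀ s ∈ S, 0 < f s a) (hb : ∀ s ∈ S, f s b < 0) :
    ∃ g : ℝ → ℝ, ContinuousOn g S ∧ ∀ s ∈ S, g s ∈ Ioo a b ∧ f s (g s) = 0 := by
  -- continuity of each section
  have hsec : ∀ s ∈ S, ContinuousOn (f s) (Icc a b) := by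
    intro s hs
    have h1 : ContinuousOn (fun φ : ℝ ↦ ((s, φ) : ℝ × ℝ)) (Icc a b) :=
      (Continuous.prodMk_right s).continuousOn
    exact hf.comp h1 fun φ hφ ↦ ⟨hs, hφ⟩
  -- existence of a zero in `(a, b)` for each `s`
  have hzero : ∀ s ∈ S, ∃ φ ∈ Ioo a b, f s φ = 0 := by
    intro s hs
    have hivt := intermediate_value_Icc' hab (hsec s hs)
    obtain ⟨φ, hφ, h0⟩ := hivt ⟨(hb s hs).le, (ha s hs).le⟩
    refine ⟨φ, ⟨lt_of_le_of_ne hφ.1 ?_, lt_of_le_of_ne hφ.2 ?_⟩, h0⟩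
    · rintro rfl; exact (ha s hs).ne' h0
    · rintro rfl; exact (hb s hs).ne h0
  choose! g hg using hzero
  refine ⟨g, ?_, fun s hs ↦ hg s hs⟩
  -- continuity: squeeze the zero between `φ₀ ± ε`
  intro s₀ hs₀
  rw [Metric.continuousWithinAt_iff]
  intro ε hε
  obtain ⟨⟨hga, hgb⟩, hg0⟩ := hg s₀ hs₀
  set φ₀ := g s₀ with hφ₀
  set φm := max a (φ₀ - ε / 2) with hφm
  set φp := min b (φ₀ + ε / 2) with hφp
  have hφm_mem : φm ∈ Icc a b := ⟨le_max_left _ _, max_le hab (by linarith)⟩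
  have hφp_mem : φp ∈ Icc a b := ⟨le_min hab (by linarith), min_le_left _ _⟩
  have hφ₀_mem : φ₀ ∈ Icc a b := ⟨hga.le, hgb.le⟩
  have hlt_m : φm < φ₀ := max_lt hga (by linarith)
  have hlt_p : φ₀ < φp := lt_min hgb (by linarith)
  have hpos : 0 < f s₀ φm := by rw [← hg0]; exact hanti s₀ hs₀ hφm_mem hφ₀_mem hlt_m
  have hneg : f s₀ φp < 0 := by rw [← hg0]; exact hanti s₀ hs₀ hφ₀_mem hφp_mem hlt_p
  -- continuity of `f(·, φm)` and `f(·, φp)` at `s₀` within `S`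
  have hcm : ContinuousWithinAt (fun s ↦ f s φm) S s₀ := by
    have h1 : ContinuousWithinAt (fun s : ℝ ↦ ((s, φm) : ℝ × ℝ)) S s₀ :=
      (Continuous.prodMk_left φm).continuousWithinAt
    exact ContinuousWithinAt.comp (f := fun s : ℝ ↦ ((s, φm) : ℝ × ℝ)) (g := fun q : ℝ × ℝ ↦ f q.1 q.2)
      (hf (s₀, φm) ⟨hs₀, hφm_mem⟩) h1 (fun s hs ↦ ⟨hs, hφm_mem⟩)
  have hcp : ContinuousWithinAt (fun s ↦ f s φp) S s₀ := by
    have h1 : ContinuousWithinAt (fun s : ℝ ↦ ((s, φp) : ℝ × ℝ)) S s₀ :=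
      (Continuous.prodMk_left φp).continuousWithinAt
    exact ContinuousWithinAt.comp (f := fun s : ℝ ↦ ((s, φp) : ℝ × ℝ)) (g := fun q : ℝ × ℝ ↦ f q.1 q.2)
      (hf (s₀, φp) ⟨hs₀, hφp_mem⟩) h1 (fun s hs ↦ ⟨hs, hφp_mem⟩)
  have hev : ∀ᶠ s in 𝓝[S] s₀, 0 < f s φm ∧ f s φp < 0 :=
    ((hcm.eventually (lt_mem_nhds hpos)).and (hcp.eventually (gt_mem_nhds hneg)))
  obtain ⟨δ, hδ, hδsub⟩ := Metric.mem_nhdsWithin_iff.1 hev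
  refine ⟨δ, hδ, fun s hs hdist ↦ ?_⟩
  obtain ⟨h1, h2⟩ := hδsub ⟨hdist, hs⟩
  obtain ⟨⟨hsa, hsb⟩, hs0⟩ := hg s hs
  have hgs_mem : g s ∈ Icc a b := ⟨hsa.le, hsb.le⟩
  -- `φm < g s < φp`
  have hm' : φm < g s := by
    by_contra hle
    push Not at hle
    have := (hanti s hs).antitoneOn hgs_mem hφm_mem hle
    linarith
  have hp' : g s < φp := by
    by_contra hle
    push Not at hle
    have := (hanti s hs).antitoneOn hφp_mem hgs_mem hle
    linarith
  rw [Real.dist_eq, abs_lt]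
  constructor <;> [have := le_max_right a (φ₀ - ε / 2); have := min_le_right b (φ₀ + ε / 2)] <;> linarith

end DHEpstein

end Literature.Barriers.RiemannHypothesis
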